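import Summits.BirchSwinnertonDyer.BirchSwinnertonDyer.Theses.KatoDescentTamePotSupersingular
import Summits.BirchSwinnertonDyer.Rank1Residual.X11b.KolyvaginBottomPoint
import Summits.BirchSwinnertonDyer.Rank1Residual.X11b.Three.KolyvaginLine
import Summits.BirchSwinnertonDyer.Rank1Residual.X11b.BDPRouteRankOneBookkeeping
import Literature.NumberTheory.EllipticCurves.HeegnerPointsOfConductorOneData
import Literature.NumberTheory.EllipticCurves.HeegnerPointsOfConductorOneRationalityProofs
import Literature.NumberTheory.EllipticCurves.HeegnerPointsOfConductorOneGaloisConjProofs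
import Literature.NumberTheory.EllipticCurves.HeegnerPointsKolyvaginPrimaryGeneratorProofs
import Literature.NumberTheory.EllipticCurves.BSDSelmerCMPConverseHeegnerFieldProofs
import Literature.NumberTheory.EllipticCurves.CuspFormLFunctionLevelConductorProofs
import HarnessLib
import Summits.BirchSwinnertonDyer.BirchSwinnertonDyer.Theses.KatoDescentPotSupersingular
import Summits.BirchSwinnertonDyer.BirchSwinnertonDyer.Theorems.KatoDescentTamePotSupersingularJetchevIrreducibleReadingOfStubs
import Summits.BirchSwinnertonDyer.BirchSwinnertonDyer.Theorems.KatoDescentPotSupersingularJetchevIrreducibleReadingOfStubs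
import Summits.BirchSwinnertonDyer.BirchSwinnertonDyer.Theorems.KatoDescentTamePotSupersingularJetchevIrreducibleReadingDivisibilityCoreVertexBridge
import Summits.BirchSwinnertonDyer.BirchSwinnertonDyer.Theorems.KatoDescentTamePotSupersingularJetchevIrreducibleReadingDivisibilityCoreVertexBridgePrimed
import Summits.BirchSwinnertonDyer.BirchSwinnertonDyer.Theorems.Rank1ResidualJetRingClassFields
import Summits.BirchSwinnertonDyer.BirchSwinnertonDyer.Theorems.KatoDescentTamePotSupersingularJetchevIrreducibleReadingThm52KernelInputsIrred
import Summits.BirchSwinnertonDyer.BirchSwinnertonDyer.Theorems.KatoDescentTamePotSupersingularJetchevIrreducibleReadingThm52KernelInputsCebotarev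
import Summits.BirchSwinnertonDyer.BirchSwinnertonDyer.Theorems.KatoDescentTamePotSupersingularJetchevIrreducibleReadingThm52CarrierEndFormCebotarev
import Summits.BirchSwinnertonDyer.BirchSwinnertonDyer.Theorems.KatoDescentTamePotSupersingularJetchevIrreducibleReadingThm52NamedPrintOnly
import Summits.BirchSwinnertonDyer.BirchSwinnertonDyer.Theorems.KatoDescentTamePotSupersingularJetchevIrreducibleReadingThm52NamedPrintOnlyPB2
import Summits.BirchSwinnertonDyer.BirchSwinnertonDyer.Theorems.KatoDescentTamePotSupersingularJetchevIrreducibleProp47OfGross37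

/-!
**ADOPTED as skeleton v7 by planner bsd-potss-plan g23 (2026-08-27T16:32Z)** — k8t-c4 g11's candidate
(`pub/bsd-potss/k8t-c4/JetchevIrreducibleReadingByName_birth_v7c_candidate.lean`, sha16 1df84082cfe7128e) byte-identical below this note; supersedes the registered v6
(@ 9e1091d7b22d, archived `Lines/v6_closedLocalFacts_g23.lean (ns .BirthV6)`). S5 RE-KEY DECISION (planner, INBOX 16:3xZ): keying **(i)** — the image-free
`GrossLMS1991.prop37_2_frobeniusCongruence` ((A′) verbatim in print, bsd-cited r05 S12) with the `l ≠ 2` guard on the swapped prime;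
the per-row inert fact v2 (`prop37_2_reductionCongruence_inert`, p539858) stays DERIVED from it for any later per-row consumer.
`lean check`: rc 0, six `sorry`s = six stubs, the `_of` compositions REAL proofs concluding the route decls BY NAME.
HONEST FRAMING unchanged: conditional skeleton; nothing booked; the crux and BSD as open as before.
-/

/-!
**JOINT v7 CANDIDATE "v7c" (prover bsd-potss-k8t-c4 g11, 2026-08-27T15:4xZ; NOT registered — for the planner).**
= k9-c4 g9's candidate `v7np` (this file below the second note, byte-identical except where said: S6 ↦ `stub_thm52NamedPrint`
:= hPT ∧ hGZ-guarded, node over `…ReadingThm52NamedPrintOnly` p54xxxx) WITH the S5 lane's re-cut merged in: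
* S5 `stub_prop44Irred` ↦ **`stub_prop47IrredP2`** := [McC] Prop. 4.4 / [J] Prop. 4.7 read irreducible, PRIMED
  (`(p : ℤ) ∣ W.conductorNorm ℤ` after irreducibility, as S2′/S3′), WEAKENED to the (B)-conjunct (the order comparison;
  (A) is the row theorem p530898 and no consumer uses it) and GUARDED `l ≠ 2` (the print boundary of Gross 3.7 (2) as typed;
  a Zhang–Kolyvagin prime 2 forces p = 3; the RowData layer now picks its Čebotarev primes outside {2} ∪ primes(c)) — the
  binder `h47P2` of this seat's v2 chain (`…Theorems.JetchevIrreducibleH63P2`: Prop47Adapter2 → ReadingThm52RowDataPB2 →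
  ReadingThm52KernelInputsNoProp53PB2 (= k9-c4 p536529 re-keyed) → LocalFactsNamedPrintPB2 (= k9-c4 p539290 re-keyed) →
  ReadingThm52NamedPrintOnlyPB2 (= k9-c4's NamedPrintOnly re-keyed)) VERBATIM;
* **S5 is DISCHARGED modulo ONE published fact**: `stub_prop47IrredP2_of_prop37_2 : GrossLMS1991.prop37_2_frobeniusCongruence →
  Sig.stub_prop47IrredP2` := this seat's `JetchevIrreducibleProp44.h47P2_of_prop37_2` (p541604; over cell bsd-stepL corner-p1 g10's
  Zhang pair END p539541, bsd-stepL-lit g24's fact p534286/p535266, and the (A)-half p530898). If the planner prefers, S5 can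
  therefore leave the stub list altogether (node proved from the fact + S6), making the fact a `conditional-result` binder of
  the crux instead of a stub; this file keeps it as a stub so that `stubs_max` bookkeeping and the K9 twin stay aligned.
* node: `H63IRowObjectsAddv_of h47 hNP := JetchevIrreducibleH63P2.h63IRowObjectsAddv_of_poitouTate_of_GZ31_of_prop47P2 h47 hNP.1 hNP.2`.
`lean check`: rc 0, six `sorry`s = six stubs, `_of` / `_of_K9` REAL proofs concluding the decls by name. After this cut:
20165 ⟸ S1 (MN19 structure thm, print) ∧ S2′ ∧ S3′ (readings of McCallum 5.2 / Jetchev 5.3 — the genuine open mathematics) ∧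
{hPT (Poitou–Tate, named fact), hGZ ([GZ86 III (3.1)], print)} ∧ [Gross 3.7 (2), print] ∧ S7 (held). HONEST FRAMING: conditional
throughout; nothing booked; the crux, its stubs and BSD are as open as before.
-/

/-!
**CANDIDATE v7 (prover k9-c4 g9, 2026-08-27T14:3xZ) = registered v6 (plan g23 @ 9e1091d7b22d, sha16 8db4b4e57abe) with the hardest stub
`stub_thm52ClosedLocalFacts` (8 closed statements) RE-CUT to `stub_thm52NamedPrint` (2 closed NAMED-PRINT statements: hPT Poitou–Tate ∧
hGZ [GZ86 III (3.1)] Kolyvagin-guarded), composed through k9-c4 g9's end form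
`JetchevIrreducibleReadingThm52NamedPrintOnly.h63IRowObjectsAddv_of_poitouTate_of_GZ31` (Gross 5.3 struck at the point of use, p533295; the four
local statements bsd-jet theorems, p532411; the last completion-layer gap h49str a theorem given hGZ, p535775). SHARED with the 19941 v5
candidate byte-for-byte (stub text and name). Everything below this note is the registered v6 text except the stub block, one import and
the composition line of `H63IRowObjectsAddv_of`; `lean check`: rc 0, sorries ONLY in `stub_*` (6 stubs).**

**ADOPTED as skeleton v6 by planner bsd-potss-plan g23 (2026-08-27T11:55Z)** — k8t-c4 g10's candidate
(`pub/bsd-potss/k8t-c4/JetchevIrreducibleReadingByName_birth_v6_candidate.lean`, sha16 efef8d721a2d31c6) byte-identical below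
this note; supersedes the registered v5 (sha 781170fc0df6, archived `Lines/v5_primed_g22.lean`, ns `.BirthV5`). `lean check`
rc 0, six `sorry`s = six stubs, `JetchevIrreducibleReadingByName_of` / `_of_K9` REAL proofs concluding the K8-t′ / K9 decls by
name. STUB MAP v6 (seven slots of stubs_max, six used): S1 `stub_structureIrred` (shared 19941) · S2′ `stub_prop52IrredP`
(shared) · S3′ `stub_coreVertexExistenceIrredP` (shared) · S5 `stub_prop44Irred` (shared) · **S6 `stub_thm52ClosedLocalFacts`
(hardest; shared byte-for-byte with 19941 v4 — ONE proof `--supports` both items)** · S7 `stub_publishedInputsHeegner` (held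
alias, never a prover target). PLANNED v7 CUT (when 19941's idle `stub_gaussianSupplement` drops at the queued `d_K ≠ −4`
restate, freeing the seventh slot on both items): S6 ↦ S6a `stub_thm52PublishedLocalInputs` := conjuncts (1) hPT (Milne ADT
I 4.10(b), named fact `poitouTate_selmerStructure_duality_conj`), (2) h53 (Gross 1991 Prop. 5.3), (3) hGZ ([GZ86] III (3.1))
— PRINTED theorems, destined to become HELD by-name published-input children of this crux at split time, never prover
targets — and S6b `stub_thm52LocalGaps` := conjuncts (4)–(8) (hloc, h𝒯σ, h𝒯sd, htr, h49str) — the genuine prover work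
(bsd-jet layers T1/T2/L1/completion, ported by name). Until then provers land conjuncts (4)–(8) as separate theorems
`--supports stmt-BirchSwinnertonDyer-20165` (and `-19941`) and the planner re-cuts.
-/

/-!
**v6 CANDIDATE (prover bsd-potss-k8t-c4 g10, 2026-08-27T11:1xZ; NOT registered — for the planner).** v5 with the hardest stub
RE-CUT: `stub_thm52KernelGapsAddv` (the `∃ 𝒯 𝒮 Qcar e′ C′ …` kernel-inputs currency of bsd-jet p501299) ↦ `stub_thm52ClosedLocalFacts`,
the conjunction of EIGHT CLOSED, image-free, row-free statements (hPT, h53, hGZ, hloc, h𝒯σ, h𝒯sd, htr, h49str — bsd-jet's road-K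
end-form binders VERBATIM), through k8t-c4 g10's `JetchevIrreducibleReadingThm52.h63IRowObjectsAddv_of_closedLocalFacts` (p526159,
over k9-c4 g8's `JetchevIrreducibleLocalFacts.tamagawaExponent_le_mInfty_of_localFacts_of_irreducible_of_heegner` and k8t-c4 g10's
p524630). DISCHARGED w.r.t. v5: hCM1, hCM2, the structures with hT/hS/hQcar, C′/hC, hdual_q, hdual_ℓ, h49tr, (δ), hΦ. Everything
else byte-identical to v5 (registered sha 781170fc0df6). Six `sorry`s, all in stubs.
-/

/-!
**v5 (planner bsd-potss-plan g22, 2026-08-27T10:3xZ).** v4 with the two McCallum/Jetchev READINGS PRIMED: `stub_prop52IrredP`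
([McC] Prop. 5.2 read irreducible) and `stub_coreVertexExistenceIrredP` ([J] Prop. 5.3 read irreducible) now carry the row binder
`(p : ℤ) ∣ W.conductorNorm ℤ` right after `W.HasIrreducibleModPGaloisRep p` (every row of both faces is ADDITIVE at `p`, so the
composition feeds it from `Addv`; the unprimed v4 readings also quantified over good `p`, where no consumer needs them and where
k8t-c4 g9's dihedral-corner analysis of h32I counsels caution). Bodies = the binders `h52I` / `hCVI` of k9-c4 g8's PRIMED BRIDGE
`JetchevIrreducibleReadingDivisibilityPrimed.divisibilityIrredAddv_of_prop52IrredP_of_coreVertexExistenceIrredP_of_thm63` (p521540)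
VERBATIM, and byte-identical to the stubs of the same names in k9-c4 g8's candidate skeleton v2.1 of crux 19941 (one proof serves
both items). Other stubs (S1 `stub_structureIrred`, S5 `stub_prop44Irred`, S6 `stub_thm52KernelGapsAddv` (hardest), S7
`stub_publishedInputsHeegner`) byte-identical to v4 (registered sha 7582fe03aabf, superseded). Six `sorry`s, all in stubs.
NEXT (v6, when k8t-c4 g10 lands the irreducible port of bsd-jet's H63 layers `…_of_localFacts_of_irreducible_of_heegner`): S6 re-cut to
bsd-jet's closed-statement list (C′, hdual_q, hdual_ℓ, 𝒯/hT, h49tr, h𝒮σ, Weil datum discharged).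

# Crux `JetchevIrreducibleReadingByName` (item stmt-BirchSwinnertonDyer-20165, shared K8-t′ / K9) — skeleton v4
# (planner `bsd-potss-plan` g22, 2026-08-27; v3 = git history of this file @ 9eaa6f035676 / sha 256ec88ec5ba, v2 @ cfebba652cc8, v1 @ cb754136f12a)

WHY v4. `bsd-potss-k8t-c4` g9 showed that v3's stub `stub_cor32Irred` (= p508713's displayed reading `h32I`: McCallum Cor. 3.2
with `onto` ↦ `E[p]` irreducible, NO Heegner hypothesis, NO `p ∣ N`) is FALSE as a ∀-statement — in the dihedral corner
`K ⊆ ℚ(E[p])` a `Γ_K`-endomorphism `A` with `τAτ⁻¹ = −A` turns every eigen-class `c` into an independent eigen-class `A_*c`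
with identical local orders, so the prescribed-orders prime set is EMPTY (explicit instance: `y² = x³ − 6x + 8`, `p = 3`,
`K = ℚ(√−2)`, kit j273881; memo `pub/bsd-potss/k8t-c4/FINDING-20165-cebotarev-irreducible-k8t-c4-g9.md` §3) — and PROVED the
repaired reading `h32I′ := h32I + SatisfiesHeegnerHypothesis (W.conductorNorm ℤ) K + p ∣ W.conductorNorm ℤ` for all odd `p`
(`JetchevIrreducibleCebotarev.cor32_localOrder_of_irreducible_of_heegner`, p516209, over p512847 / p514435 / p515261: Cor. 3.2 at
level `p^M` for ANY image with (Z)(S)(C), discharged over `K` from `ρ̄(Γ_K) = ρ̄(Γ_ℚ)` for `K` unramified at `p` and at the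
bad primes), then re-issued g8's kernel theorem WITHOUT the binder `h32I`
(`JetchevIrreducibleReadingThm52.tamagawaExponent_le_mInfty_of_kernelInputs_of_irreducible_of_heegner`). v4 = v3 with `stub_cor32Irred` DROPPED
(a theorem is imported by name, never registered — planner rule g17 (v); the false display is recorded DEAD) and
`H63IRowObjectsAddv_of h44 hKG` re-proved through the new theorem; SIX stubs, hardest unchanged `stub_thm52KernelGapsAddv`.
KNOWN RISK carried (g9 §3, to be removed in v5 together with a re-issued bridge `S2DivisibilityIrredAddv_of`): `stub_prop52IrredP` /
`stub_coreVertexExistenceIrredP` carry the Heegner hypothesis and `d_K ∉ {−3,−4}` but not `p ∣ N` (corner `K = ℚ(√−p)`).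

WHY v3. `bsd-potss-k8t-c4` g8 CUT v2's hardest stub `stub_thm52RowObjectsAddv` ([J] Thm. 5.2 for the row objects at an
ADDITIVE `p`, `E[p]` IRREDUCIBLE) IN THE KERNEL: `JetchevIrreducibleReadingThm52.tamagawaExponent_le_mInfty_of_kernelInputs_of_irreducible`
(p508713, over p507503 bricks / p507696 adapters / p508077 row form) = bsd-jet's H63 assembly with the `p`-adic tower
replaced by `hirr + p ∣ N`, needing per row (after g9) ONLY the READING `h44I` ([McC] Prop. 4.4, irreducible) plus bsd-jet's tower-case RESIDUAL (named print `hCM1`, `hCM2`, Gross Prop. 5.3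
`h53`, [GZ86 III (3.1)] `hGZ`/`hcop′`; kernel gaps `htr`, `h49str`, `h49tr`, `hdual_q`, `hdual_ℓ` for SOME structures
`𝒯 𝒮 Qcar C′`). v3 makes exactly these the registered targets: v2's `Sig.stub_thm52RowObjectsAddv` becomes the PROVED
node `Sig.H63IRowObjectsAddv` (`H63IRowObjectsAddv_of`, a real proof through g9's Čebotarev-free kernel theorem) over TWO
stubs, and the stub set is (6; each a genuine piece, none the crux reworded):

* `stub_structureIrred` (S1, v1-verbatim; MN19 Thm 0.7/§0.11 structure theorem, irreducible, no reduction binder —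
  = Literature `MatarNekovar2019.thm07_…` p503175 in substance, published input, XL);
* `stub_prop52IrredP` (v2-verbatim; McCallum Prop. 5.2 read under irreducibility — READING);
* `stub_coreVertexExistenceIrredP` (v2-verbatim; Jetchev Prop. 5.3 = arXiv Prop. 6.4 read under irreducibility — READING);
* (v3's `stub_cor32Irred` — DROPPED in v4: false as displayed, true + PROVED with the row binders, see WHY v4;)
* `stub_prop44Irred` (NEW = p508713's `h44I` verbatim: [McC] Prop. 4.4 — the local-condition comparison of the classes
  `P(mℓ)` vs `P(m)` at `λ ∣ ℓ` — irreducible reading);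
* `stub_thm52KernelGapsAddv` (NEW, **hardest**: for the ROW OBJECTS of v2's H63I binders — additive `p`, `p ∤ c_p`,
  global Tamagawa binder, `q ∥ N`, `q ≠ p`, core vertex `c` at level `k > max(t, m_∞)`, `t = ord_p c_q` — the named
  print `hCM1 ∧ hCM2 ∧ ∃ε h53 ∧ ∃n′ hGZ` holds AND there EXIST Selmer structures `𝒯` (transverse at the primes of `c`),
  `𝒮 ≤` Kummer, carrier places `Qcar` disjoint from `c`, `e′ = ε(−1)^r`, `C′ ≤` the `−e′` sign part, satisfying the
  five kernel gaps = Jetchev's Prop. 4.9 (stringent/transverse parts), Thm. 5.1 at the carrier with `#dual = p^t`, and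
  Thm. 5.1/Lemma 5.2 (iii) at `λ` — i.e. bsd-jet register row D5's residual instantiated at an additive `p`);
* `stub_publishedInputsHeegner` (cite; the route's held conjunction `PublishedInputsHeegner`, item 19914).

`JetchevIrreducibleReadingByName_of` (K8-t′ decl) / `_of_K9` (K9 decl, shared signature) are REAL proofs from the six
stubs (g8's capstones p502280 / p502729, the S2 cut p504157 / p504855, and g9's kernel theorem). `lean check`: sorries ONLY in
`stub_*` (6). HONEST FRAMING: conditional throughout; nothing booked; the crux, its stubs and BSD are as open as before.
Alternative lines on this crux: `Lines/alt_depthIndex_plan_g21.lean` (planner's depth-index cut); v2 / v3 in git history.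
Source of the cut: bsd-potss-k8t-c4 g8 FINDING v3 §§5–6 and g9 FINDING (`pub/bsd-potss/k8t-c4/FINDING-20165-{irreducible-roadK-k8t-c4-g8,cebotarev-irreducible-k8t-c4-g9}.md`).

References: [cite: Jetchev2008, Cor. 1.5, Thm. 1.4, Prop. 4.4, Prop. 4.9, Lemma 5.1, Thm. 5.1, Prop. 5.3, Thm. 5.2 (p. 821), Rem. 6.2]
[cite: MatarNekovar2019, Thm. 0.7, §0.11] [cite: McCallumLMS1991, §3 Cor. 3.2, §4 Prop. 4.4, Prop. 5.2, Cor. 5.6]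
[cite: GrossLMS1991, §3, Prop. 5.3, Prop. 5.4, Prop. 6.2 (1)] [cite: GrossZagier1986, III (3.1)] [cite: Cox2013, §9.A]
-/


set_option linter.dupNamespace false
set_option autoImplicit false

noncomputable section

open scoped Classical

open WeierstrassCurve IsDedekindDomain NumberField Literature.NumberTheory.EllipticCurves
open Literature.NumberTheory.EllipticCurves.Jetchev2008
open Literature.NumberTheory.GaloisRepresentations Literature.NumberTheory.GaloisRepresentations.DiscreteGaloisModule
open Summit.BirchSwinnertonDyer.Rank1Residual.JET
open Literature.NumberTheory.EllipticCurves.ModularForms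
open Literature.NumberTheory.EllipticCurves.Rank1Residual
open Summit.BirchSwinnertonDyer.Rank1Residual Summit.BirchSwinnertonDyer.Rank1Residual.X11b
open Summit.BirchSwinnertonDyer.BirchSwinnertonDyer.Theses.KatoDescentTamePotSupersingular
open Summit.BirchSwinnertonDyer.BirchSwinnertonDyer.Theorems
open Summit.BirchSwinnertonDyer.BirchSwinnertonDyer.Theorems.JetchevIrreducibleReadingDivisibility
open Field Literature.NumberTheory.GaloisCohomology Summit.BirchSwinnertonDyer.Rank1Residual.X11b.Three
open Summit.BirchSwinnertonDyer.Rank1Residual.JET.SelmerVocabulary Literature.NumberTheory.Automorphic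
open scoped Pointwise

namespace Summit.BirchSwinnertonDyer.BirchSwinnertonDyer.Cruxes.JetchevIrreducibleReadingByName.BirthV7

/-- Statement of `stub_structureIrred` (S1): Kolyvagin's structure theorem, UPPER half, under IRREDUCIBILITY of
`E[p]`, with NO reduction-type binder at `p` (McCallum currency): `ord_p #Ш(E/K)[p^∞] + 2t ≤ 2M₀`
(`p^{M₀} ∥ y_K` in `E(K)`) when every derived Heegner point is `p^s`-divisible at every depth `s ≤ t`.
= `Cha2005.rmk25_padicValNat_card_sha_primary_add_le_of_globalDivisibility` minus `p ∤ d_K`, `p² ∤ N`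
(Matar–Nekovář 2019 Thm. 0.7 + §0.11; McCallum 1991 Cor. 5.6). -/
abbrev Sig.stub_structureIrred : Prop :=
  ∀ (W : WeierstrassCurve ℚ) [W.IsElliptic] [W.IsGloballyMinimal] [NeZero (W.conductorNorm ℤ)],
    ¬ W.HasCM →
    ∀ (K : Type) [Field K] [NumberField K], IsImaginaryQuadratic K →
    NumberField.discr K ≠ -3 → NumberField.discr K ≠ -4 →
    SatisfiesHeegnerHypothesis (W.conductorNorm ℤ) K →
    ∀ (p : ℕ) [Fact p.Prime], p ≠ 2 → W.HasIrreducibleModPGaloisRep p →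
    ∀ (Dt : ModularParametrizationData W (W.conductorNorm ℤ)) (β : ℤ) (ι : K →+* ℂ)
      (d₁ : KolyvaginHeegnerData Dt β ι 1) (P : (W.baseChange K).toAffine.Point),
      d₁.toGeomPoints d₁.derivedPoint = toGeomPoints (W.baseChange K) P →
      ¬ IsOfFinAddOrder P →
    ∀ (M₀ : ℕ),
      (∃ Q : (W.baseChange K).toAffine.Point, ((p ^ M₀ : ℕ) : ℤ) • Q = P) →
      (¬ ∃ Q : (W.baseChange K).toAffine.Point, ((p ^ (M₀ + 1) : ℕ) : ℤ) • Q = P) →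
    ∀ (t : ℕ),
      (∀ (s : ℕ), s ≤ t → ∀ (n : ℕ) (d : KolyvaginHeegnerData Dt β ι n), Squarefree n →
        (∀ ℓ ∈ n.primeFactors, Zhang2014.IsKolyvaginPrime (W.conductorNorm ℤ) W K p ℓ ∧
          s ≤ Zhang2014.kolyvaginIndex W p ℓ) →
        ∃ Q : (W.baseChange (ringClassField K ι n)).toAffine.Point,
          ((p ^ s : ℕ) : ℤ) • Q = d.derivedPoint) →
    padicValNat p (Nat.card (AddCommGroup.primaryComponent (W.baseChange K).sha p)) + 2 * t ≤ 2 * M₀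

abbrev Sig.S2DivisibilityIrredAddv : Prop :=
  ∀ (W : WeierstrassCurve ℚ) [W.IsElliptic] [W.IsGloballyMinimal] [NeZero (W.conductorNorm ℤ)],
    ¬ W.HasCM →
    ∀ (K : Type) [Field K] [NumberField K], IsImaginaryQuadratic K →
    NumberField.discr K ≠ -3 → NumberField.discr K ≠ -4 →
    SatisfiesHeegnerHypothesis (W.conductorNorm ℤ) K →
    ∀ (p : ℕ) [Fact p.Prime], p ≠ 2 → Addv W p → 0 ≤ padicValRat p W.j →
    W.HasIrreducibleModPGaloisRep p →
    ¬ p ∣ (W.baseChange ℚ_[p]).localTamagawaNumber ℤ_[p] →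
    (∀ (q' : ℕ) [Fact q'.Prime], q' ∣ W.conductorNorm ℤ →
      p ∣ (W.baseChange ℚ_[q']).localTamagawaNumber ℤ_[q'] → ¬ q' ^ 2 ∣ W.conductorNorm ℤ) →
    ∀ (Dt : ModularParametrizationData W (W.conductorNorm ℤ)) (β : ℤ) (ι : K →+* ℂ)
      (d₁ : KolyvaginHeegnerData Dt β ι 1), ¬ IsOfFinAddOrder d₁.derivedPoint →
    ∀ (q : ℕ) [Fact q.Prime], q ∣ W.conductorNorm ℤ → ¬ q ^ 2 ∣ W.conductorNorm ℤ → q ≠ p →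
    ∀ (s : ℕ), s ≤ padicValNat p ((W.baseChange ℚ_[q]).localTamagawaNumber ℤ_[q]) →
    ∀ (n : ℕ) (d : KolyvaginHeegnerData Dt β ι n), Squarefree n →
      (∀ ℓ ∈ n.primeFactors, Zhang2014.IsKolyvaginPrime (W.conductorNorm ℤ) W K p ℓ ∧
        s ≤ Zhang2014.kolyvaginIndex W p ℓ) →
      ∃ Q : (W.baseChange (ringClassField K ι n)).toAffine.Point,
        ((p ^ s : ℕ) : ℤ) • Q = d.derivedPoint

/-- Statement of `stub_prop52IrredP`: McCallum 1991 Prop. 5.2 («`M_r < M ⟹ ∃ c ∈ Λ^r_M` with `ord P(c)` of exact order `p^{M−M_r}`») in the IRREDUCIBLE reading — the `p`-adic-tower / surjectivity binder replaced by `W.HasIrreducibleModPGaloisRep p` (valid under absolute irreducibility by Jetchev 2008 Rem. 6.2: the proof uses the image only through the Čebotarev Cor. 3.2). VERBATIM the hypothesis `h52I` of `divisibilityIrredAddv_of_prop52Irred_of_coreVertexExistenceIrred_of_thm63` (p504855). A READING, displayed, nothing asserted. [cite: McCallumLMS1991, §5 Prop. 5.2 (p. 304), §3 Cor. 3.2]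 [cite: Jetchev2008, Rem. 6.2] — v5: PRIMED reading (+ `(p : ℤ) ∣ W.conductorNorm ℤ` after irreducibility; fed from `Addv` in the composition), body = binder `h52I` of k9-c4 g8's primed bridge p521540 verbatim. -/
abbrev Sig.stub_prop52IrredP : Prop :=
  ∀ (W : WeierstrassCurve ℚ) [W.IsElliptic] [W.IsGloballyMinimal] [NeZero (W.conductorNorm ℤ)],
      ¬ W.HasCM →
      ∀ (K : Type) [Field K] [NumberField K], IsImaginaryQuadratic K →
      NumberField.discr K ≠ -3 → NumberField.discr K ≠ -4 →
      SatisfiesHeegnerHypothesis (W.conductorNorm ℤ) K →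
      ∀ (p : ℕ) [Fact p.Prime], p ≠ 2 → W.HasIrreducibleModPGaloisRep p → (p : ℤ) ∣ W.conductorNorm ℤ →
      ∀ (Dt : ModularParametrizationData W (W.conductorNorm ℤ)) (β : ℤ) (ι : K →+* ℂ)
        (d₁ : KolyvaginHeegnerData Dt β ι 1), ¬ IsOfFinAddOrder d₁.derivedPoint →
      ∀ (r : ℕ), 0 < r →
      ∀ (Mr : ℕ),
        IsLeast {u : ℕ | ∃ (n : ℕ) (d : KolyvaginHeegnerData Dt β ι n), Squarefree n ∧
            n.primeFactors.card = r ∧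
            (∀ ℓ ∈ n.primeFactors, Zhang2014.IsKolyvaginPrime (W.conductorNorm ℤ) W K p ℓ ∧
              u + 1 ≤ Zhang2014.kolyvaginIndex W p ℓ) ∧
            (∃ Q : (W.baseChange (ringClassField K ι n)).toAffine.Point,
              ((p ^ u : ℕ) : ℤ) • Q = d.derivedPoint) ∧
            ¬ ∃ Q : (W.baseChange (ringClassField K ι n)).toAffine.Point,
              ((p ^ (u + 1) : ℕ) : ℤ) • Q = d.derivedPoint} Mr →
      ∀ (M : ℕ), Mr < M →
        ∃ (n : ℕ) (d : KolyvaginHeegnerData Dt β ι n), Squarefree n ∧ n.primeFactors.card = r ∧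
          (∀ ℓ ∈ n.primeFactors, Zhang2014.IsKolyvaginPrime (W.conductorNorm ℤ) W K p ℓ ∧
            M ≤ Zhang2014.kolyvaginIndex W p ℓ) ∧
          addOrderOf (d.kolyvaginClass (Fact.out : p.Prime) M) = p ^ (M - Mr) ∧
          (∃ Q : (W.baseChange (ringClassField K ι n)).toAffine.Point,
            ((p ^ Mr : ℕ) : ℤ) • Q = d.derivedPoint) ∧
          ¬ ∃ Q : (W.baseChange (ringClassField K ι n)).toAffine.Point,
            ((p ^ (Mr + 1) : ℕ) : ℤ) • Q = d.derivedPoint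

/-- Statement of `stub_coreVertexExistenceIrredP`: Jetchev 2008 Prop. 5.3 (= arXiv:math/0703431 Prop. 6.4: a core vertex of every level `m ≥ 1` above a conductor with non-torsion, exactly-`p^s`-divisible derived point and `s + m ≤ M(c)`) in the IRREDUCIBLE reading — bsd-jet's reading binder `JET.JetchevCoreVertexExistence` with its tower binder replaced by `W.HasIrreducibleModPGaloisRep p`. VERBATIM the hypothesis `hCVI` of p504855. A READING, displayed, nothing asserted. [cite: Jetchev2008, Prop. 5.3 (p. 823), Lemma 5.1, Rem. 6.2] — v5: PRIMED reading (+ `(p : ℤ) ∣ W.conductorNorm ℤ`), body = binder `hCVI` of p521540 verbatim. -/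
abbrev Sig.stub_coreVertexExistenceIrredP : Prop :=
  ∀ (W : WeierstrassCurve ℚ) [W.IsElliptic] [W.IsGloballyMinimal] [NeZero (W.conductorNorm ℤ)],
      ¬ W.HasCM →
      ∀ (K : Type) [Field K] [NumberField K], IsImaginaryQuadratic K →
      NumberField.discr K ≠ -3 → NumberField.discr K ≠ -4 →
      SatisfiesHeegnerHypothesis (W.conductorNorm ℤ) K →
      ∀ (τ : K ≃ₐ[ℚ] K), τ ≠ 1 →
      ∀ (p : ℕ) [Fact p.Prime], p ≠ 2 → W.HasIrreducibleModPGaloisRep p → (p : ℤ) ∣ W.conductorNorm ℤ →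
      ∀ (Dt : ModularParametrizationData W (W.conductorNorm ℤ)) (β : ℤ) (ι : K →+* ℂ)
        [∀ k : ℕ, NumberField (ringClassField K ι k)]
        (d₁ : KolyvaginHeegnerData Dt β ι 1), ¬ IsOfFinAddOrder d₁.derivedPoint →
      ∀ (m : ℕ), 1 ≤ m →
      ∀ (c : ℕ) (d : KolyvaginHeegnerData Dt β ι c), Squarefree c →
        (∀ ℓ ∈ c.primeFactors, Zhang2014.IsKolyvaginPrime (W.conductorNorm ℤ) W K p ℓ) →
      ∀ (s : ℕ), ¬ IsOfFinAddOrder d.derivedPoint →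
        (∃ Q : (W.baseChange (ringClassField K ι c)).toAffine.Point,
          ((p ^ s : ℕ) : ℤ) • Q = d.derivedPoint) →
        (¬ ∃ Q : (W.baseChange (ringClassField K ι c)).toAffine.Point,
          ((p ^ (s + 1) : ℕ) : ℤ) • Q = d.derivedPoint) →
        ((s + m : ℕ) : ℕ∞) ≤ Zhang2014.levelIndex W p c →
        ∃ (c' : ℕ) (d' : KolyvaginHeegnerData Dt β ι c'), Squarefree c' ∧
          (∀ ℓ ∈ c'.primeFactors, Zhang2014.IsKolyvaginPrime (W.conductorNorm ℤ) W K p ℓ ∧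
            m + s ≤ Zhang2014.kolyvaginIndex W p ℓ) ∧
          Jetchev2008.IsGlobalCoreVertex W K ι τ p m c' ∧
          ¬ IsOfFinAddOrder d'.derivedPoint ∧
          ¬ ∃ Q : (W.baseChange (ringClassField K ι c')).toAffine.Point,
            ((p ^ (s + 1) : ℕ) : ℤ) • Q = d'.derivedPoint

/-- v2's `Sig.stub_thm52RowObjectsAddv`, NO LONGER A STUB since v3 (v4: proved from `stub_prop44Irred`,
`stub_thm52KernelGapsAddv` by `H63IRowObjectsAddv_of` through g9's Čebotarev-free kernel theorem): [J] Thm. 5.2 (= arXiv Thm. 6.3, the core-vertex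
kernel bound `ord_p c_q ≤ m_∞`) INSTANTIATED for the row objects under the additive-`p` binders. Body byte-identical to
v2's stub. [cite: Jetchev2008, Thm. 5.2 (p. 821)] -/
abbrev Sig.H63IRowObjectsAddv : Prop :=
   ∀ (W : WeierstrassCurve ℚ) [W.IsElliptic] [W.IsGloballyMinimal] [NeZero (W.conductorNorm ℤ)],
    ¬ W.HasCM → ∀ (K : Type) [Field K] [NumberField K], IsImaginaryQuadratic K →
    NumberField.discr K ≠ -3 → NumberField.discr K ≠ -4 →
    SatisfiesHeegnerHypothesis (W.conductorNorm ℤ) K →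
    ∀ (τ : K ≃ₐ[ℚ] K), τ ≠ 1 →
    ∀ (p : ℕ) [Fact p.Prime], p ≠ 2 → Rank1Residual.Addv W p → 0 ≤ padicValRat p W.j →
    W.HasIrreducibleModPGaloisRep p →
    ¬ p ∣ (W.baseChange ℚ_[p]).localTamagawaNumber ℤ_[p] →
    (∀ (q' : ℕ) [Fact q'.Prime], q' ∣ W.conductorNorm ℤ →
      p ∣ (W.baseChange ℚ_[q']).localTamagawaNumber ℤ_[q'] → ¬ q' ^ 2 ∣ W.conductorNorm ℤ) →
    ∀ (Dt : ModularParametrizationData W (W.conductorNorm ℤ)) (β : ℤ) (ι : K →+* ℂ)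
      [∀ k : ℕ, NumberField (ringClassField K ι k)]
      (d₁ : KolyvaginHeegnerData Dt β ι 1), ¬ IsOfFinAddOrder d₁.derivedPoint →
    ∀ (q : ℕ) [Fact q.Prime], q ∣ W.conductorNorm ℤ → ¬ q ^ 2 ∣ W.conductorNorm ℤ → q ≠ p →
    ∀ (mdiv m : {c : ℕ // Squarefree c ∧ ∀ ℓ ∈ c.primeFactors,
        Zhang2014.IsKolyvaginPrime (W.conductorNorm ℤ) W K p ℓ} → ℕ∞),
    (∀ c (u : ℕ), (u : ℕ∞) ≤ mdiv c ↔ ∀ d : KolyvaginHeegnerData Dt β ι c.1,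
      ∃ Q : (W.baseChange (ringClassField K ι c.1)).toAffine.Point,
        ((p ^ u : ℕ) : ℤ) • Q = d.derivedPoint) →
    (∀ c, m c = if mdiv c < Zhang2014.levelIndex W p c.1 then mdiv c else ⊤) →
    ∀ mInf : ℕ, (∀ c, (mInf : ℕ∞) ≤ m c) →
      (∀ m' : ℕ, ∃ c, (m' : ℕ∞) ≤ Zhang2014.levelIndex W p c.1 ∧ m c = mInf) →
    ∀ (k : ℕ) c, 1 ≤ k → Jetchev2008.IsGlobalCoreVertex W K ι τ p k c.1 → m c = mInf →
      (k : ℕ∞) + mInf ≤ Zhang2014.levelIndex W p c.1 →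
      padicValNat p ((W.baseChange ℚ_[q]).localTamagawaNumber ℤ_[q]) < k → mInf < k →
      padicValNat p ((W.baseChange ℚ_[q]).localTamagawaNumber ℤ_[q]) ≤ mInf

/-- Statement of `stub_prop47IrredP2` (v7c; replaces v3–v6's `stub_prop44Irred` = p508713's `h44I`): McCallum 1991 Prop. 4.4 /
Jetchev 2008 Prop. 4.7 — at a place `λ ∣ ℓ` of `K`, for COMPATIBLE Kolyvagin–Heegner data of conductors `m` and `mℓ` (all prime
factors Zhang–Kolyvagin of index `≥ M`, `ℓ ≠ 2`), the ORDER COMPARISON `p^j•c_M(mℓ) ∈ Ker_λ ↔ p^j•c_M(m) ∈ Ker_λ` (conjunct (B)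
of the v6 text), read with `E[p]` irreducible and PRIMED with `(p : ℤ) ∣ W.conductorNorm ℤ` (fed from `Addv`). = the binder
`h47P2` of k8t-c4 g11's v2 chain VERBATIM. **A THEOREM modulo the published fact Gross 1991 Prop. 3.7 (2)**
(`stub_prop47IrredP2_of_prop37_2` below, = `JetchevIrreducibleProp44.h47P2_of_prop37_2`, p541604). The guard `ℓ ≠ 2` is the
boundary of the fact as typed (Nekovář 2007 Prop. 4.13 (ii)); it costs nothing (Čebotarev primes avoid any finite set).
[cite: McCallumLMS1991, §4 Prop. 4.4] [cite: Jetchev2008, Prop. 4.4, Prop. 4.7, Rem. 6.2] [cite: GrossLMS1991, Prop. 3.7 (2), Prop. 6.2 (2)]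
[cite: Nekovar2007, Prop. 4.13 (ii)] -/
abbrev Sig.stub_prop47IrredP2 : Prop :=
  ∀ (W : WeierstrassCurve ℚ) [W.IsElliptic] [W.IsGloballyMinimal] [NeZero (W.conductorNorm ℤ)],
        ¬ W.HasCM →
        ∀ (K : Type) [Field K] [NumberField K], IsImaginaryQuadratic K →
        NumberField.discr K ≠ -3 → NumberField.discr K ≠ -4 →
        SatisfiesHeegnerHypothesis (W.conductorNorm ℤ) K →
        ∀ (p : ℕ) [Fact p.Prime], p ≠ 2 → W.HasIrreducibleModPGaloisRep p → (p : ℤ) ∣ W.conductorNorm ℤ →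
        ∀ (Dt : ModularParametrizationData W (W.conductorNorm ℤ)) (β : ℤ) (ι : K →+* ℂ)
          (M : ℕ), 1 ≤ M →
        ∀ (m l : ℕ), Squarefree (m * l) → l.Prime → l ≠ 2 → ¬ l ∣ m →
          (∀ l' ∈ (m * l).primeFactors, Zhang2014.IsKolyvaginPrime (W.conductorNorm ℤ) W K p l' ∧
            M ≤ Zhang2014.kolyvaginIndex W p l') →
        ∀ (d : KolyvaginHeegnerData Dt β ι m) (d' : KolyvaginHeegnerData Dt β ι (m * l)),
          (∀ l' ∈ m.primeFactors, ∀ (x : ringClassField K ι m) (x' : ringClassField K ι (m * l)),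
            (x : ℂ) = x' → ((d'.σ l' x' : ringClassField K ι (m * l)) : ℂ) = (d.σ l' x : ℂ)) →
          (∀ s ∈ d.S, ∃ s' ∈ d'.S, ∀ (x : ringClassField K ι m) (x' : ringClassField K ι (m * l)),
            (x : ℂ) = x' → ((s' x' : ringClassField K ι (m * l)) : ℂ) = (s x : ℂ)) →
          (∀ s' ∈ d'.S, ∃ s ∈ d.S, ∀ (x : ringClassField K ι m) (x' : ringClassField K ι (m * l)),
            (x : ℂ) = x' → ((s' x' : ringClassField K ι (m * l)) : ℂ) = (s x : ℂ)) →
          (∀ (x : ringClassField K ι m) (x' : ringClassField K ι (m * l)),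
            (x : ℂ) = x' → d'.emb x' = d.emb x) →
        ∀ (v : HeightOneSpectrum (𝓞 K)), (l : 𝓞 K) ∈ v.asIdeal →
        ∀ (j : ℕ),
          (((p ^ j : ℕ) : ℤ) • d'.kolyvaginClass (Fact.out : p.Prime) M ∈
              (W.baseChange K).torsionLocalKer (v.adicCompletion K) ((p ^ M : ℕ) : ℤ) ↔
            ((p ^ j : ℕ) : ℤ) • d.kolyvaginClass (Fact.out : p.Prime) M ∈
              (W.baseChange K).torsionLocalKer (v.adicCompletion K) ((p ^ M : ℕ) : ℤ))

/-! `stub_thm52NamedPrint` below is the NAMED-PRINT-ONLY re-cut of `stub_thm52ClosedLocalFacts` (registered: 20165 v6 / 19941 v4,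
eight closed statements): conjunct (1) `hPT` BYTE-FOR-BYTE; conjunct (3) `hGZ` RE-CLOSED WITH THE PRINTED GUARDS (bsd-jet read-1
ADD-9 ANNEX-5 §2: the unguarded `∀ W p m` closure is satisfiability-unverified); conjuncts (2) `h53` (Gross 5.3: the sign of the
Kolyvagin class is a THEOREM on the irreducible row, k9-c4 g9 p533295), (4) `hloc`, (5) `h𝒯σ`, (6) `h𝒯sd`, (7) `htr` (bsd-jet
theorems of 2026-08-27, fed by name since p531200/p532411) and (8) `h49str` (Jetchev Prop. 4.9 proper — a THEOREM given `hGZ` on the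
irreducible row, k9-c4 g9 p535775, irreducible port of bsd-jet pv-1 g7's K-GAP-2 p532810) DROPPED. Same text on both items (SHARED:
one proof, `--supports` both). -/

/-- Statement of `stub_thm52NamedPrint` (NEW, **hardest**; replaces `stub_thm52ClosedLocalFacts`): the conjunction of TWO CLOSED,
image-free, row-free NAMED-PRINT statements from which k9-c4 g9's end forms
`JetchevIrreducibleReadingThm52NamedPrintOnly.h63IRowObjectsAddv_of_poitouTate_of_GZ31` (20165's node `Sig.H63IRowObjectsAddv`, carrier
`q ≠ p`) and `WildJetchevBoundAtPNamedPrintOnly.thm63AtP_of_poitouTate_of_GZ31` (19941's H63Ip, carrier at `p`) prove [J] Thm. 5.2 for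
the row objects together with `stub_prop44Irred`:
(1) `hPT` — Poitou–Tate duality for the tree's Selmer structures at every number field (named fact
`JET.poitouTate_selmerStructure_duality_conj`; Milne ADT I Thm. 4.10 + local Tate duality with a conjugation-compatible perfect family;
bsd-jet ARM P) — NAMED PRINT;
(2) `hGZ` — [GZ86 III (3.1)] / Gross 1991 §6 (proof of Prop. 6.2 (1)) in the receptacle form: ONE `n′` prime to `p` with
`n′ • y_m^γ ∈ E⁰(K̄_v)` (and the same for `y_{m/ℓ}` read at level `m`) at every bad place `v` of `E/K`, CLOSED WITH THE PRINTED
GUARDS: `K` a Heegner field for `N_E`, `p` odd with `E[p]` irreducible (so `E(ℚ)[p] = 0` and `n′ := #E(ℚ)_tors` is prime to `p`),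
`m` square-free with Zhang–Kolyvagin prime factors (so `m ≥ 1`, `gcd(m, N_E) = 1` — Gross §3 «n ≥ 1 … prime to N») — NAMED PRINT
(schema). NOTE for the typer/planner: the tree's Literature fact `Gross1991_heegnerPoint_sub_ratTorsion_mem_E0` (p471738) is
Gross-scoped (`ρ̄_{E,p}` ONTO, `E` non-CM, `d_K ∉ {−3,−4}`), so it does NOT feed (2) on the irreducible non-surjective rows of this
crux; the printed source [GZ86 III (3.1)] is image-free (a statement about Heegner divisors on `X₀(N)`), so (2) wants an
image-free re-type of that fact (bsd-jet ty g8's T4 transport `hGZ_of_Gross1991` then ports verbatim).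
WHY IT MIGHT FAIL: (1) is conjecture-shaped pending ARM P; (2) is printed ([GZ86 III (3.1)] at every bad place incl. `p² ∣ N`; no
primary text held, acq-00078) but not a tree theorem, and its only typed form is surjective-scoped. Sources: k9-c4 g9 p531200, p532411,
p533295, p535775, p536529 + the `…NamedPrintOnly` end forms; bsd-jet `Rank1ResidualJetCarrierMultEndFormClosed.lean`, sheets
PV2-J6-KERNEL ADD-4/5, D-AUDIT-JET-read-1 ADD-9 ANNEX-5. [cite: Jetchev2008, Prop. 4.9, Thm. 5.1, Thm. 5.2 (p. 821)]
[cite: GrossZagier1986, III (3.1)] [cite: GrossLMS1991, §3, §6 Prop. 6.2 (1)] [cite: MilneADT2006, Ch. I, Thm. 4.10(b)] -/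
abbrev Sig.stub_thm52NamedPrint : Prop :=
    (∀ (K : Type) [Field K] [NumberField K], poitouTate_selmerStructure_duality_conj K) ∧
    (∀ (W : WeierstrassCurve ℚ) [W.IsElliptic] [W.IsGloballyMinimal] [NeZero (W.conductorNorm ℤ)]
      (K : Type) [Field K] [NumberField K], IsImaginaryQuadratic K →
      SatisfiesHeegnerHypothesis (W.conductorNorm ℤ) K →
      ∀ (p : ℕ) [Fact p.Prime], p ≠ 2 → W.HasIrreducibleModPGaloisRep p →
      ∀ (Dt : ModularParametrizationData W (W.conductorNorm ℤ)) (β : ℤ) (ι : K →+* ℂ)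
      [∀ j : ℕ, NumberField (ringClassField K ι j)],
      ∃ n' : ℤ, IsCoprime (p : ℤ) n' ∧ ∀ (m : ℕ), Squarefree m →
        (∀ q ∈ m.primeFactors, Zhang2014.IsKolyvaginPrime (W.conductorNorm ℤ) W K p q) →
        ∀ (dm : KolyvaginHeegnerData Dt β ι m)
        (γ : ringClassField K ι m ≃ₐ[ℚ] ringClassField K ι m), γ ∈ ringClassGal ι m →
        ∀ v : HeightOneSpectrum (𝓞 K), ¬ (W.baseChange K).HasGoodReductionAt v →
          n' • pointsMap (W.baseChange K) (v.adicCompletion K)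
              (dm.toGeomPoints (pointGalHom W (ringClassField K ι m) γ dm.y)) ∈
            E0Receptacle (W.baseChange K) v ∧
          ∀ (ℓ : ℕ), ℓ ∈ m.primeFactors → ∀ (dm' : KolyvaginHeegnerData Dt β ι (m / ℓ))
            (hle : ringClassField K ι (m / ℓ) ≤ ringClassField K ι m),
            n' • pointsMap (W.baseChange K) (v.adicCompletion K)
                (dm.toGeomPoints (pointGalHom W (ringClassField K ι m) γ
                  (WeierstrassCurve.Affine.Point.map (W' := W)
                    ((RingClassField.inclusion ι hle).restrictScalars ℚ) dm'.y))) ∈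
              E0Receptacle (W.baseChange K) v)

/-- Statement of `stub_publishedInputsHeegner` (cite): the route's HELD conjunction `PublishedInputsHeegner`
(item 19914) BY NAME — byte-identical to v1. -/
abbrev Sig.stub_publishedInputsHeegner : Prop := PublishedInputsHeegner

theorem stub_structureIrred : Sig.stub_structureIrred := by
  sorry

theorem stub_prop52IrredP : Sig.stub_prop52IrredP := by
  sorry

theorem stub_coreVertexExistenceIrredP : Sig.stub_coreVertexExistenceIrredP := by
  sorry

theorem stub_prop47IrredP2 : Sig.stub_prop47IrredP2 := by
  sorry

/-- **S5 DISCHARGED modulo ONE published fact** (Gross 1991 Prop. 3.7 (2) = `GrossLMS1991.prop37_2_frobeniusCongruence`):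
k8t-c4 g11's `JetchevIrreducibleProp44.h47P2_of_prop37_2` (p541604). A REAL proof, conditional on the named fact only.
[cite: GrossLMS1991, Prop. 3.7 (2)] [cite: McCallumLMS1991, §4 Prop. 4.4] -/
theorem stub_prop47IrredP2_of_prop37_2
    (h37 : Literature.NumberTheory.EllipticCurves.GrossLMS1991.prop37_2_frobeniusCongruence) :
    Sig.stub_prop47IrredP2 :=
  JetchevIrreducibleProp44.h47P2_of_prop37_2 h37

theorem stub_thm52NamedPrint : Sig.stub_thm52NamedPrint := by
  sorry

theorem stub_publishedInputsHeegner : Sig.stub_publishedInputsHeegner := by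
  sorry

/-- **The node `Sig.H63IRowObjectsAddv` is PROVED from the primed (B)-only `ℓ ≠ 2` reading `stub_prop47IrredP2` and the two named-print
statements of `stub_thm52NamedPrint`** (v7c: k8t-c4 g11's `JetchevIrreducibleH63P2.h63IRowObjectsAddv_of_poitouTate_of_GZ31_of_prop47P2` = k9-c4's
NamedPrintOnly re-keyed) — superseding: by k8t-c4 g10's end form `h63IRowObjectsAddv_of_closedLocalFacts` (p526159: bsd-jet's
road-K end form ported to the irreducible, Čebotarev-free base; `p ∣ N` from `Addv`, split carrier place, row data by
`carrierRowData_of_split`, `Φ_q` cyclic by `kodairaNeron_isAddCyclic_forall`, `h49tr` from `htr` at level `cℓ`). A REAL proof.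
[cite: Jetchev2008, Thm. 5.2 (p. 821) and proof] -/
theorem H63IRowObjectsAddv_of (h47 : Sig.stub_prop47IrredP2)
    (hLF : Sig.stub_thm52NamedPrint) : Sig.H63IRowObjectsAddv :=
  JetchevIrreducibleH63P2.h63IRowObjectsAddv_of_poitouTate_of_GZ31_of_prop47P2 h47 hLF.1 hLF.2

/-- **S2 of v1 is now PROVED from the three new stubs** (g8's kernel cut p504855, with `hRCF` discharged by
`JET.numberField_ringClassField`): the body of v1's `Sig.stub_divisibilityIrredAddv`, renamed
`Sig.S2DivisibilityIrredAddv` (no longer a stub). [cite: Jetchev2008, Thm. 1.4 (ii), Prop. 5.3, Thm. 5.2] -/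
theorem S2DivisibilityIrredAddv_of (h52 : Sig.stub_prop52IrredP) (hCV : Sig.stub_coreVertexExistenceIrredP)
    (h63 : Sig.H63IRowObjectsAddv) : Sig.S2DivisibilityIrredAddv :=
  JetchevIrreducibleReadingDivisibilityPrimed.divisibilityIrredAddv_of_prop52IrredP_of_coreVertexExistenceIrredP_of_thm63
    h52 hCV
    (fun K _ _ ι hK k ↦ Summit.BirchSwinnertonDyer.Rank1Residual.JET.numberField_ringClassField K hK ι k) h63

/-- **The crux from the six stubs (K8-t′ decl)** — g8's capstone p502280 fed with S1, the proved S2 and PIH.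
A REAL proof; sorries only inside the stubs. [cite: Jetchev2008, Cor. 1.5 (p. 812)] [cite: MatarNekovar2019, Thm. 0.7, §0.11] -/
theorem JetchevIrreducibleReadingByName_of (hS : Sig.stub_structureIrred) (h52 : Sig.stub_prop52IrredP)
    (hCV : Sig.stub_coreVertexExistenceIrredP) (h47 : Sig.stub_prop47IrredP2)
    (hKG : Sig.stub_thm52NamedPrint) (hH : Sig.stub_publishedInputsHeegner) :
    Summit.BirchSwinnertonDyer.BirchSwinnertonDyer.Theses.KatoDescentTamePotSupersingular.JetchevIrreducibleReadingByName :=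
  JetchevIrreducibleReadingOfStubs.jetchevIrreducibleReadingByName_of_structureIrred_of_divisibilityIrred_of_publishedInputsHeegner
    hS (S2DivisibilityIrredAddv_of h52 hCV (H63IRowObjectsAddv_of h47 hKG)) hH

/-- **The K9 face (shared signature)** — g8's twin capstone p502729. -/
theorem JetchevIrreducibleReadingByName_of_K9 (hS : Sig.stub_structureIrred) (h52 : Sig.stub_prop52IrredP)
    (hCV : Sig.stub_coreVertexExistenceIrredP) (h47 : Sig.stub_prop47IrredP2)
    (hKG : Sig.stub_thm52NamedPrint) (hH : Sig.stub_publishedInputsHeegner) :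
    Summit.BirchSwinnertonDyer.BirchSwinnertonDyer.Theses.KatoDescentPotSupersingular.JetchevIrreducibleReadingByName :=
  WildJetchevIrreducibleReadingOfStubs.jetchevIrreducibleReadingByName_of_structureIrred_of_divisibilityIrred_of_publishedInputsHeegner
    hS (S2DivisibilityIrredAddv_of h52 hCV (H63IRowObjectsAddv_of h47 hKG)) hH

/-- Sanity composition with the sorried stubs (what a sorry-free skeleton would deliver). -/
theorem jetchevIrreducibleReadingByName_of_stubs :
    Summit.BirchSwinnertonDyer.BirchSwinnertonDyer.Theses.KatoDescentTamePotSupersingular.JetchevIrreducibleReadingByName :=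
  JetchevIrreducibleReadingByName_of stub_structureIrred stub_prop52IrredP stub_coreVertexExistenceIrredP
    stub_prop47IrredP2 stub_thm52NamedPrint stub_publishedInputsHeegner

end Summit.BirchSwinnertonDyer.BirchSwinnertonDyer.Cruxes.JetchevIrreducibleReadingByName.BirthV7

end
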